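import Mathlib
import HarnessLib
import Literature.AlgebraicGeometry.Resolution.FundamentalLocus
import Literature.AlgebraicGeometry.Resolution.FiniteBirationalNormal
import Literature.AlgebraicGeometry.Resolution.BirationalDimensionInequality
import Literature.AlgebraicGeometry.Motives.GoodReductionSpecialFibreProofs
import Summits.ResolutionOfSingularities.ResolutionOfSingularities.Theorems.HomologicalConductorSurfaceTerminationGenusChart
import Summits.ResolutionOfSingularities.ResolutionOfSingularities.Theorems.HomologicalConductorSurfaceTerminationGoodCover

/-!
# Kill test `SurfaceTermination` (stmt-ResolutionOfSingularities-16488), LINE genus-descent, stub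
# `stub_pgNonincreasing` (U2e): the good affine cover of the middle model from the iso locus of the chart

`[OURS · L W4.4]` Cell res-hironaka, crux chain W4.4, kill test K4.4-s; U2e ASSEMBLY, supplier of the
cover input of `hasGeometricGenusLE_of_chart` (res-D-pv-045).  Nothing here is a statement of the
manuscript under review (Hironaka 2017); AI-written, weaker than expert review.

Setting: `g_B : B → Spec T` proper birational, `B` integral, `dim T ≤ 2`; an open immersion
`ι_C : Spec C → B` (the chart `W₀`); `σ_B : Z → B`; a NORMAL Noetherian domain `N` with a morphism
`ν : Spec N → B`, locally of finite type and birational, and a proper birational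
`σ : V = σ_B⁻¹(W₀) → Spec N` with the TRIANGLE `σ ≫ ν = V.ι ≫ σ_B` and `ν` landing in `W₀`.

* `finite_setOf_not_mem_isoLocus` — the points of `Spec N` over which `σ` is not an isomorphism are
  finitely many, each of codimension `2` (normal points of dimension `≤ 1` lie in the iso locus,
  `FundamentalLocus.mem_isoLocus_of_ringKrullDim_le_one`; `dim Spec N ≤ 2`).
* `isClosed_singleton_of_two_le_coheight` — a point of codimension `≥ 2` of a scheme of dimension
  `≤ 2` is closed.  With the dimension inequality for `ν` (`coheight n ≤ coheight (ν n)`, tree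
  `coheight_le_of_isIso_stalkMap_genericPoint`) the images of the bad points are CLOSED in `B`.
* `exists_goodCover_isAffineOpen_mixed` — GoodCover (res-L0-w44-stub-4) then gives a finite affine
  cover `{W₀} ∪ {W_b}` of `B` whose mixed pieces `σ_B⁻¹(W₀ ∩ W_b) ≅ ν⁻¹(W_b) ⊆` iso locus are
  AFFINE, hence `Ȟ¹`-acyclic (`hvan` of the core theorem).
* `hasGeometricGenusLE_of_chart'` — the core theorem of `…GenusChart` with this supplier plugged in.

References: O. Piltant, RACSAM 107 (2013), proof of Prop. 5.1 Step 3 [`Piltant2013`]; H. Matsumura,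
*Commutative Ring Theory* (1987), Thm. 15.5 [`Matsumura1987`]; U. Görtz, T. Wedhorn, *Algebraic Geometry
II* (2023), Lemma 22.1, Cor. 24.44 [`GortzWedhorn2023`].
-/

-- single-problem summit: the doubled namespace component `ResolutionOfSingularities` is forced
set_option linter.dupNamespace false

noncomputable section

open CategoryTheory CategoryTheory.Limits AlgebraicGeometry TopologicalSpace IsLocalRing
open Literature.AlgebraicGeometry.Resolution Literature.AlgebraicGeometry.Morphisms
open Summit.ResolutionOfSingularities.ResolutionOfSingularities.Theorems

namespace Summit.ResolutionOfSingularities.ResolutionOfSingularities.Theorems.SurfaceTermination.GenusDescent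

/-! ## Birationality of a factor -/

/-- **Birationality of a factor**: if `q : M → S` and `s ≫ q : Y → S` are birational, with `Y` and
`M` irreducible, then so is `s` (adapted from the tree's `Descent.isBirational_of_comp`,
`Theorems/WeightedInvariantDescentPerfectToAllOneRootNormalization`). [cite: StacksProject, Tag 01RN] -/
theorem isBirational_of_comp' {Y M S : Scheme.{0}} [IrreducibleSpace Y] [IrreducibleSpace M]
    {s : Y ⟶ M} {q : M ⟶ S} (hq : IsBirational q) (h : IsBirational (s ≫ q)) :
    IsBirational s := by
  obtain ⟨U₁, hU₁, -, hiso₁⟩ := h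
  obtain ⟨U₂, hU₂, -, hiso₂⟩ := hq
  haveI : Nonempty S := ⟨q (Classical.arbitrary M)⟩
  have hne : ((U₁ ⊓ U₂ : S.Opens) : Set S).Nonempty := by
    rw [Opens.coe_inf, Set.inter_comm]
    exact hU₁.inter_open_nonempty U₂ U₂.2 hU₂.nonempty
  haveI h₁ : IsIso ((s ≫ q) ∣_ (U₁ ⊓ U₂)) := isIso_morphismRestrict_of_le _ hiso₁ inf_le_left
  haveI h₂ : IsIso (q ∣_ (U₁ ⊓ U₂)) := isIso_morphismRestrict_of_le _ hiso₂ inf_le_right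
  obtain ⟨x, hx⟩ := hne
  let y : ↥((s ≫ q) ⁻¹ᵁ (U₁ ⊓ U₂)) :=
    (Scheme.homeoOfIso (asIso ((s ≫ q) ∣_ (U₁ ⊓ U₂)))).symm ⟨x, hx⟩
  have hy : (y : Y) ∈ (s ≫ q) ⁻¹ᵁ (U₁ ⊓ U₂) := y.2
  refine ⟨q ⁻¹ᵁ (U₁ ⊓ U₂), ?_, ?_, ?_⟩
  · exact (q ⁻¹ᵁ (U₁ ⊓ U₂)).2.dense
      ⟨s y, show q (s y) ∈ U₁ ⊓ U₂ by rw [← Scheme.Hom.comp_apply]; exact hy⟩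
  · rw [← Scheme.Hom.comp_preimage]
    exact ((s ≫ q) ⁻¹ᵁ (U₁ ⊓ U₂)).2.dense ⟨y, hy⟩
  · haveI : IsIso (s ∣_ q ⁻¹ᵁ (U₁ ⊓ U₂) ≫ q ∣_ (U₁ ⊓ U₂)) := by
      rw [← morphismRestrict_comp]
      exact h₁
    exact IsIso.of_isIso_comp_right (s ∣_ q ⁻¹ᵁ (U₁ ⊓ U₂)) (q ∣_ (U₁ ⊓ U₂))

/-! ## Points of codimension two are closed in dimension two -/

/-- In a scheme of dimension `≤ 2`, a point of codimension `≥ 2` is closed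
(`height + coheight ≤ dim`, so `height = 0`; schemes are `T₀`). [cite: EGAIV2, 5.1.1] -/
theorem isClosed_singleton_of_two_le_coheight {B : Scheme.{0}} (hB : topologicalKrullDim B ≤ 2)
    {b : B} (hb : 2 ≤ Order.coheight b) : IsClosed ({b} : Set B) := by
  have h := (coe_height_add_coheight_le_topologicalKrullDim b).trans hB
  have h0 : Order.height b = 0 := by
    have h' : Order.height b + Order.coheight b ≤ 2 := by
      have h2 : ((Order.height b + Order.coheight b : ℕ∞) : WithBot ℕ∞) ≤ ((2 : ℕ∞) : WithBot ℕ∞) := h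
      exact WithBot.coe_le_coe.mp h2
    have hc : Order.coheight b ≠ ⊤ := by
      intro ht; rw [ht, add_top] at h'; exact absurd h' (by decide)
    obtain ⟨c, hc'⟩ := ENat.ne_top_iff_exists.mp hc
    rw [← hc'] at h' hb
    have hh : Order.height b ≠ ⊤ := by
      intro ht; rw [ht, top_add] at h'; exact absurd h' (by decide)
    obtain ⟨a, ha⟩ := ENat.ne_top_iff_exists.mp hh
    rw [← ha] at h' ⊢
    have : a + c ≤ 2 := by exact_mod_cast h'
    have : 2 ≤ c := by exact_mod_cast hb
    have : a = 0 := by omega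
    simp [this]
  -- `height b = 0`: `b` is minimal for specialisation, hence closed (`T₀`)
  have hcl : closure ({b} : Set B) = {b} := by
    refine Set.Subset.antisymm (fun y hy => ?_) subset_closure
    have hby : b ⤳ y := specializes_iff_mem_closure.2 hy
    have hle : y ≤ b := Scheme.le_iff_specializes.2 hby
    have hmin : IsMin b := Order.height_eq_zero.1 h0
    have hyb : y ⤳ b := Scheme.le_iff_specializes.1 (hmin hle)
    exact (hyb.antisymm hby).eq
  rw [← hcl]
  exact isClosed_closure

/-! ## The bad locus of the chart resolution is finite -/

/-- **The points over which a proper birational `σ : V → Spec N` (`V` integral, `N` a normal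
Noetherian domain with `dim Spec N ≤ 2`) fails to be an isomorphism are finitely many, each of
codimension `≥ 2`**: normal points of dimension `≤ 1` lie in the iso locus (Zariski; Piltant 2013),
so a bad point has a local ring of dimension `≥ 2`, hence is a closed point of `Spec N` (maximal
ideal); the bad locus is closed, and a closed set of maximal ideals of a Noetherian ring is finite
(each is a minimal prime of its vanishing ideal). [cite: Piltant2013, proof of Prop. 5.1, Step 3] -/
theorem finite_setOf_not_mem_isoLocus {N : Type} [CommRing N] [IsDomain N] [IsNoetherianRing N]
    [IsIntegrallyClosed N] (hdimN : topologicalKrullDim (Spec (.of N)) ≤ 2)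
    {V : Scheme.{0}} [IsIntegral V] (σ : V ⟶ Spec (.of N)) [IsProper σ] (hσ : IsBirational σ) :
    {n : Spec (.of N) | n ∉ σ.isoLocus}.Finite ∧
      ∀ n : Spec (.of N), n ∉ σ.isoLocus → 2 ≤ Order.coheight n := by
  classical
  haveI : IsDomain (CommRingCat.of N) := ‹IsDomain N›
  haveI : IsNoetherianRing (CommRingCat.of N) := ‹IsNoetherianRing N›
  haveI : IsIntegrallyClosed (CommRingCat.of N) := ‹IsIntegrallyClosed N›
  -- codimension `≥ 2` at the bad points
  have hcoh : ∀ n : Spec (.of N), n ∉ σ.isoLocus → 2 ≤ Order.coheight n := by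
    intro n hn
    by_contra hlt
    rw [not_le] at hlt
    have hdim : ringKrullDim ((Spec (.of N)).presheaf.stalk n) ≤ 1 := by
      rw [ringKrullDim_stalk_eq_coheight]
      have : Order.coheight n ≤ 1 := Order.le_of_lt_add_one (by exact_mod_cast hlt)
      exact_mod_cast this
    exact hn (mem_isoLocus_of_ringKrullDim_le_one σ hσ ⊤
      (fun q _ => Literature.AlgebraicGeometry.Motives.isIntegrallyClosed_stalk_Spec (.of N) q)
      (Opens.mem_top n) hdim)
  refine ⟨?_, hcoh⟩
  -- bad points are closed points, i.e. maximal ideals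
  have hmax : ∀ n : Spec (.of N), n ∉ σ.isoLocus → n.asIdeal.IsMaximal := by
    intro n hn
    rw [← PrimeSpectrum.isClosed_singleton_iff_isMaximal]
    exact isClosed_singleton_of_two_le_coheight hdimN (hcoh n hn)
  -- the bad locus is the zero locus of an ideal, all of whose points are minimal primes of it
  have hclosed : IsClosed {n : Spec (.of N) | n ∉ σ.isoLocus} := by
    have : {n : Spec (.of N) | n ∉ σ.isoLocus} = (σ.isoLocus : Set (Spec (.of N)))ᶜ := rfl
    rw [this]
    exact σ.isoLocus.2.isClosed_compl
  obtain ⟨J, hJ⟩ := (PrimeSpectrum.isClosed_iff_zeroLocus_ideal _).mp hclosed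
  have hsub : {n : Spec (.of N) | n ∉ σ.isoLocus} ⊆
      (PrimeSpectrum.asIdeal : Spec (.of N) → Ideal N) ⁻¹' J.minimalPrimes := by
    intro n hn
    have hJn : J ≤ n.asIdeal := by
      have : n ∈ PrimeSpectrum.zeroLocus (J : Set N) := by rw [← hJ]; exact hn
      exact this
    obtain ⟨q, hq, hqn⟩ := Ideal.exists_minimalPrimes_le hJn
    have hqprime : q.IsPrime := hq.1.1
    have hqF : (⟨q, hqprime⟩ : Spec (.of N)) ∈ {n : Spec (.of N) | n ∉ σ.isoLocus} := by
      rw [hJ]; exact hq.1.2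
    have hqmax : q.IsMaximal := hmax ⟨q, hqprime⟩ hqF
    have heq : q = n.asIdeal := hqmax.eq_of_le n.2.ne_top hqn
    change n.asIdeal ∈ J.minimalPrimes
    rw [← heq]; exact hq
  exact ((Ideal.finite_minimalPrimes_of_isNoetherianRing N J).preimage
    fun a _ b _ h => PrimeSpectrum.ext h).subset hsub

/-! ## Lifting a chain of specialisations along a closed surjection -/

/-- **Codimension does not drop along the fibres of a closed continuous surjection**: if `σ : V → Y` is
universally closed and surjective and `y ∈ Y` has `coheight y ≥ 2`, some point `z` over `y` has
`coheight z ≥ 2` (specialisations lift along closed maps, one step at a time). [cite: StacksProject, Tag 0ECG] -/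
theorem exists_two_le_coheight_of_apply_eq {V Y : Scheme.{0}} (σ : V ⟶ Y) [UniversallyClosed σ]
    [Surjective σ] {y : Y} (hy : 2 ≤ Order.coheight y) : ∃ z : V, σ z = y ∧ 2 ≤ Order.coheight z := by
  obtain ⟨p, hp, hlen⟩ := Order.exists_series_of_le_coheight y hy
  have hsp : SpecializingMap σ := σ.isClosedMap.specializingMap
  -- the chain `y = p 0 < p 1 < p 2`
  have h01 : p 0 < p 1 := p.strictMono (by rw [Fin.lt_def]; simp [hlen])
  have h12 : p 1 < p 2 := p.strictMono (by rw [Fin.lt_def]; simp [hlen])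
  have hy0 : p 0 = y := by rw [← hp]; rfl
  -- lift: `z₂` over `p 2`, then `z₁ ∈ closure {z₂}` over `p 1`, then `z ∈ closure {z₁}` over `p 0`
  obtain ⟨z₂, hz₂⟩ := σ.surjective (p 2)
  obtain ⟨z₁, hz₂₁, hz₁⟩ := hsp (a := z₂) (b := p 1)
    (by rw [hz₂]; exact Scheme.le_iff_specializes.1 h12.le)
  obtain ⟨z, hz₁₀, hz⟩ := hsp (a := z₁) (b := p 0)
    (by rw [hz₁]; exact Scheme.le_iff_specializes.1 h01.le)
  refine ⟨z, by rw [hz, hy0], ?_⟩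
  -- the lifted chain is strict
  have hmono : ∀ {a b : V}, a ≤ b → σ a ≤ σ b := fun hab =>
    Scheme.le_iff_specializes.2 ((Scheme.le_iff_specializes.1 hab).map σ.continuous)
  have hlt₁ : z < z₁ := by
    refine lt_of_le_not_ge (Scheme.le_iff_specializes.2 hz₁₀) fun h => ?_
    have h' : σ z₁ ≤ σ z := hmono h
    rw [hz, hz₁] at h'
    exact (lt_iff_le_not_ge.mp h01).2 h'
  have hlt₂ : z₁ < z₂ := by
    refine lt_of_le_not_ge (Scheme.le_iff_specializes.2 hz₂₁) fun h => ?_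
    have h' : σ z₂ ≤ σ z₁ := hmono h
    rw [hz₁, hz₂] at h'
    exact (lt_iff_le_not_ge.mp h12).2 h'
  have h1 : Order.coheight z₂ + 1 ≤ Order.coheight z₁ := Order.coheight_add_one_le hlt₂
  have h2 : Order.coheight z₁ + 1 ≤ Order.coheight z := Order.coheight_add_one_le hlt₁
  calc (2 : ℕ∞) ≤ Order.coheight z₂ + 1 + 1 := by
        rw [add_assoc]; exact le_add_self
    _ ≤ Order.coheight z₁ + 1 := add_le_add h1 (le_refl 1)
    _ ≤ Order.coheight z := h2

/-- Codimension is preserved by open immersions (a chain of generisations of `z` in `V` maps to a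
chain in `Z`). [folklore] -/
theorem coheight_le_coheight_of_isOpenImmersion {V Z : Scheme.{0}} (j : V ⟶ Z) [IsOpenImmersion j]
    (z : V) : Order.coheight z ≤ Order.coheight (j z) := by
  refine Order.coheight_le_coheight_apply_of_strictMono (fun v : V => j v) (fun a b hab => ?_) z
  refine lt_of_le_not_ge ?_ fun h => ?_
  · exact Scheme.le_iff_specializes.2 ((Scheme.le_iff_specializes.1 hab.le).map j.continuous)
  · exact (lt_iff_le_not_ge.mp hab).2
      (Scheme.le_iff_specializes.2 (j.isOpenEmbedding.isInducing.specializes_iff.mp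
        (Scheme.le_iff_specializes.1 h)))

/-! ## The good cover -/

section Supplier

variable {Z B : Scheme.{0}} [IsIntegral Z] [IsIntegral B] (σB : Z ⟶ B) [IsProper σB]
  (W₀ : B.Opens)
  {N : Type} [CommRing N] [IsDomain N] [IsNoetherianRing N] [IsIntegrallyClosed N]
  (ν : Spec (.of N) ⟶ B)
  (σ : ((σB ⁻¹ᵁ W₀ : Z.Opens) : Scheme.{0}) ⟶ Spec (.of N)) [IsProper σ]

/-- **The good affine cover of the middle model.**  `B` integral, separated and locally of finite type
over `Spec T`, of dimension `≤ 2`; `σ_B : Z ⟶ B` proper birational, `Z` integral of dimension `≤ 2`; an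
affine open `W₀ ⊆ B` (the chart); `N` a normal Noetherian domain with a morphism
`ν : Spec N ⟶ B` landing in `W₀`; a proper birational `σ : V = σ_B⁻¹(W₀) ⟶ Spec N` with the TRIANGLE
`σ ≫ ν = V.ι ≫ σ_B`.  Then there is a finite affine open cover `𝒲` of `B` with a member `W_{a₀} = W₀` such
that every mixed piece `σ_B⁻¹(W₀ ∩ W_b)`, `b ≠ a₀`, is an AFFINE open of `Z`: the bad points of `σ` are
finitely many points of codimension `2` (`finite_setOf_not_mem_isoLocus`); over each lies a point of `Z`
of codimension `2` (chains lift along the closed surjection `σ`), whose image in `B` has codimension `2`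
(dimension inequality along `σ_B`) and is therefore CLOSED; GoodCover (res-L0-w44-stub-4) avoids these
images, and over the complement `σ` is an isomorphism onto the affine `ν⁻¹(W_b)`.
[cite: Piltant2013, proof of Prop. 5.1, Step 3] [cite: Matsumura1987, Thm. 15.5] -/
theorem exists_goodCover_isAffineOpen_mixed {T : Type} [CommRing T] [IsNoetherianRing T]
    (gB : B ⟶ Spec (.of T)) [IsProper gB] (hW₀ : IsAffineOpen W₀)
    (hdimB : topologicalKrullDim B ≤ 2) (hdimZ : topologicalKrullDim Z ≤ 2)
    (hσB : IsBirational σB) (hνC : Set.range ν.base ⊆ (W₀ : Set B))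
    (hσ : IsBirational σ) (htri : σ ≫ ν = (σB ⁻¹ᵁ W₀).ι ≫ σB) :
    ∃ (α : Type) (_ : Finite α) (W : α → B.Opens) (a₀ : α), W a₀ = W₀ ∧
      (∀ a, IsAffineOpen (W a)) ∧ ⨆ a, W a = ⊤ ∧
      ∀ b, b ≠ a₀ → IsAffineOpen (σB ⁻¹ᵁ (W a₀ ⊓ W b)) := by
  classical
  haveI : IsNoetherianRing (CommRingCat.of T) := ‹IsNoetherianRing T›
  haveI : IsDomain (CommRingCat.of N) := ‹IsDomain N›
  haveI : IsNoetherianRing (CommRingCat.of N) := ‹IsNoetherianRing N›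
  haveI : IsLocallyNoetherian B := LocallyOfFiniteType.isLocallyNoetherian gB
  haveI : CompactSpace B := QuasiCompact.compactSpace_of_compactSpace gB
  haveI : IsNoetherian B := {}
  haveI : IsDominant σB := hσB.isDominant
  haveI : IsDominant σ := hσ.isDominant
  haveI : Nonempty ((σB ⁻¹ᵁ W₀ : Z.Opens) : Scheme.{0}) :=
    (σ.denseRange.nonempty_iff).mpr inferInstance
  haveI : IsIntegral ((σB ⁻¹ᵁ W₀ : Z.Opens) : Scheme.{0}) := isIntegral_of_isOpenImmersion (σB ⁻¹ᵁ W₀).ι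
  -- `dim Spec N ≤ dim V ≤ dim Z ≤ 2`
  have hdimN : topologicalKrullDim (Spec (.of N)) ≤ 2 :=
    ((Literature.AlgebraicGeometry.Motives.Scheme.topologicalKrullDim_le_of_universallyClosed_of_surjective
      σ).trans (σB ⁻¹ᵁ W₀).ι.isOpenEmbedding.isInducing.topologicalKrullDim_le).trans hdimZ
  -- the bad points and their images
  obtain ⟨hFfin, hFcoh⟩ := finite_setOf_not_mem_isoLocus hdimN σ hσ
  let S : Set B := ν.base '' {n : Spec (.of N) | n ∉ σ.isoLocus}
  have hSfin : S.Finite := hFfin.image _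
  have hSc : ∀ p ∈ S, IsClosed ({p} : Set B) := by
    rintro _ ⟨n, hn, rfl⟩
    obtain ⟨z, hz, hzc⟩ := exists_two_le_coheight_of_apply_eq σ (hFcoh n hn)
    have hb : ν.base n = σB ((σB ⁻¹ᵁ W₀).ι z) := by
      rw [← hz, ← Scheme.Hom.comp_apply, htri, Scheme.Hom.comp_apply]
    rw [hb]
    refine isClosed_singleton_of_two_le_coheight hdimB (hzc.trans ?_)
    exact (coheight_le_coheight_of_isOpenImmersion (σB ⁻¹ᵁ W₀).ι z).trans
      (coheight_le_of_isIso_stalkMap_genericPoint σB hσB.isIso_stalkMap_genericPoint _)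
  have hSW : S ⊆ (W₀ : Set B) := by
    rintro _ ⟨n, -, rfl⟩
    exact hνC ⟨n, rfl⟩
  -- GoodCover
  obtain ⟨α, hα, a₀, W, hWa₀, hWaff, hWcov, hWS⟩ :=
    exists_affineCover_eq_and_disjoint W₀ hW₀ S hSfin hSc hSW
  refine ⟨α, hα, W, a₀, hWa₀, hWaff, hWcov, fun b hb => ?_⟩
  -- the mixed piece `σ_B⁻¹(W₀ ∩ W_b) = V.ι(σ⁻¹(ν⁻¹ W_b))`, and `ν⁻¹ W_b ⊆` iso locus is affine
  have hOaff : IsAffineOpen (ν ⁻¹ᵁ W b) := by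
    have h := SeparatedAffinePreimage.isAffineOpen_inf_preimage ν gB
      (isAffineOpen_top (Spec (.of N))) (hWaff b)
    rwa [top_inf_eq] at h
  have hOiso : ν ⁻¹ᵁ W b ≤ σ.isoLocus := by
    intro n hn
    by_contra hnF
    exact Set.disjoint_left.mp (hWS b hb) ⟨n, hnF, rfl⟩ hn
  haveI : IsIso (σ ∣_ ν ⁻¹ᵁ W b) :=
    isIso_morphismRestrict_of_le σ (isIso_morphismRestrict_isoLocus σ) hOiso
  have hpre : IsAffineOpen (σ ⁻¹ᵁ (ν ⁻¹ᵁ W b)) := by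
    haveI : IsAffine (ν ⁻¹ᵁ W b : Scheme.{0}) := hOaff
    exact IsAffine.of_isIso (σ ∣_ ν ⁻¹ᵁ W b)
  have himg := hpre.image_of_isOpenImmersion (σB ⁻¹ᵁ W₀).ι
  have heq : (σB ⁻¹ᵁ W₀).ι ''ᵁ (σ ⁻¹ᵁ (ν ⁻¹ᵁ W b)) = σB ⁻¹ᵁ (W a₀ ⊓ W b) := by
    rw [← Scheme.Hom.comp_preimage, htri, Scheme.Hom.comp_preimage,
      Scheme.Hom.image_preimage_eq_opensRange_inf, Scheme.Opens.opensRange_ι, hWa₀,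
      Scheme.Hom.preimage_inf]
  rwa [heq] at himg

end Supplier

/-! ## The core theorem with the supplier plugged in -/

/-- **`hasGeometricGenusLE_of_chart` with the good cover supplied**: same data as the core theorem of
`…GenusChart`, but with the chart `W₀ ⊆ B` affine, `B` of dimension `≤ 2`, `σ_B` proper birational, a
morphism `ν : Spec N → B` landing in `W₀` with the triangle `σ ≫ ν = V.ι ≫ σ_B`, and `N` normal
Noetherian — in place of the cover `𝒲` and the vanishing `hvan`, which are produced by
`exists_goodCover_isAffineOpen_mixed` and the affine vanishing of `Ȟ¹`.
[cite: GortzWedhorn2023, Cor. 24.44] [cite: Lipman1969, Proposition (1.2) (p. 199)]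
[cite: Piltant2013, proof of Prop. 5.1, Step 3] -/
theorem hasGeometricGenusLE_of_chart'
    {T : Type} [CommRing T] [IsDomain T] [IsNoetherianRing T] [IsLocalRing T]
    (hdimT : ringKrullDim T ≤ 2)
    (h12 : Lipman1969_1_2.{0}) (hGW : GortzWedhorn2023_24_44_H2.{0})
    {X : Scheme.{0}} (ξ : X ⟶ Spec (.of T)) (hξ : IsResolution ξ) (g : ℕ)
    (hbound : ∀ (ι : Type) [Finite ι] (U : ι → X.Opens), (∀ i, IsAffineOpen (U i)) →
      ⨆ i, U i = ⊤ → Module.length T (CechH1 ξ U) ≤ (g : ℕ∞))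
    {Z : Scheme.{0}} [IsIntegral Z] (τ : Z ⟶ X) [IsProper τ] (hτ : IsBirational τ)
    (hZreg : Scheme.IsRegular Z) (hdimZ : topologicalKrullDim Z ≤ 2)
    {B : Scheme.{0}} [IsIntegral B] (gB : B ⟶ Spec (.of T)) [IsProper gB] (hgB : IsBirational gB)
    (hdimB : topologicalKrullDim B ≤ 2)
    (σB : Z ⟶ B) [IsProper σB] (hσBbir : IsBirational σB) (hσB : σB ≫ gB = τ ≫ ξ)
    (W₀ : B.Opens) (hW₀ : IsAffineOpen W₀)
    {N : Type} [CommRing N] [IsDomain N] [IsNoetherianRing N] [IsIntegrallyClosed N] [Algebra T N]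
    (ν : Spec (.of N) ⟶ B) (hνC : Set.range ν.base ⊆ (W₀ : Set B))
    (σ : ((σB ⁻¹ᵁ W₀ : Z.Opens) : Scheme.{0}) ⟶ Spec (.of N)) (hσ : IsResolution σ)
    (htri : σ ≫ ν = (σB ⁻¹ᵁ W₀).ι ≫ σB)
    (hσT : (σB ⁻¹ᵁ W₀).ι ≫ (τ ≫ ξ) = σ ≫ Spec.map (CommRingCat.ofHom (algebraMap T N)))
    (T' : Type) [CommRing T'] [IsDomain T'] [Algebra N T'] (M : Submonoid N) [IsLocalization M T'] :
    HasGeometricGenusLE T' g := by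
  haveI : IsProper σ := hσ.isProper
  obtain ⟨α, _, W, a₀, hWa₀, hWaff, hWcov, hmixed⟩ := exists_goodCover_isAffineOpen_mixed σB W₀ ν σ
    gB hW₀ hdimB hdimZ hσBbir hνC hσ.isBirational htri
  subst hWa₀
  exact hasGeometricGenusLE_of_chart hdimT h12 hGW ξ hξ g hbound τ hτ hZreg gB hgB σB hσB W hWaff hWcov
    a₀ (fun b hb => by
      intro κ G hG
      exact cechZ1_le_cechB1_of_isAffineOpen_of_iSup_eq (τ ≫ ξ) (hmixed b hb) G hG)
    σ hσ hσT T' M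

end Summit.ResolutionOfSingularities.ResolutionOfSingularities.Theorems.SurfaceTermination.GenusDescent

end
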